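import Summits.KontsevichZagierPeriods.Zeta5Search.LaiSweepShard

/-!
# `κ₃` sweep certificate — shard file 106 of 127 (shards 742–748 of 889)

HONEST FRAMING. Systematic search; no irrationality claim unless certified. This file only checks,
by `decide +kernel`, shards 742–748 of the order-cell sweep of the `κ₃` point `(74, 2180, 444; δ74)`
(engine `LaiSweepEngine`, soundness `LaiSweepJump/Free/Eval/Shard/Kappa3`; a shard is `⟨regime, n,
p, q, p', q', Lo, Up⟩`: `n` cells from `p/q` to `p'/q'` with integer rate sums in `[Lo, Up]`, `K =
128`, `D = 2^40`). It draws NO conclusion: only the capstone `LaiKappa3SweepCert`, which needs all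
127 shard files, does. Kernel cost of this file ≈ 560 cells × 0.3 s.
-/

namespace Summit.KontsevichZagierPeriods.Zeta5Search.Sweep

set_option maxHeartbeats 100000000 in
/-- Shard 742: 80 cells of regime B from `305/374` to `272/333`.
[cite: Lai2024BallRivoal, §4 Lemma 4.3] -/
theorem shard742 :
    Shard.check 128 (2^40)
      ⟨true, 80, 305, 374, 272, 333, 11469519903452, 18072608908285⟩ = true := by
  decide +kernel

set_option maxHeartbeats 100000000 in
/-- Shard 743: 80 cells of regime B from `272/333` to `301/368`.
[cite: Lai2024BallRivoal, §4 Lemma 4.3] -/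
theorem shard743 :
    Shard.check 128 (2^40)
      ⟨true, 80, 272, 333, 301, 368, 9793213681043, 15446838862725⟩ = true := by
  decide +kernel

set_option maxHeartbeats 100000000 in
/-- Shard 744: 80 cells of regime B from `301/368` to `195/238`.
[cite: Lai2024BallRivoal, §4 Lemma 4.3] -/
theorem shard744 :
    Shard.check 128 (2^40)
      ⟨true, 80, 301, 368, 195, 238, 12185489508720, 19240598636864⟩ = true := by
  decide +kernel

set_option maxHeartbeats 100000000 in
/-- Shard 745: 80 cells of regime B from `195/238` to `247/301`.
[cite: Lai2024BallRivoal, §4 Lemma 4.3] -/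
theorem shard745 :
    Shard.check 128 (2^40)
      ⟨true, 80, 195, 238, 247, 301, 11108616279865, 17559581721841⟩ = true := by
  decide +kernel

set_option maxHeartbeats 100000000 in
/-- Shard 746: 80 cells of regime B from `247/301` to `143/174`.
[cite: Lai2024BallRivoal, §4 Lemma 4.3] -/
theorem shard746 :
    Shard.check 128 (2^40)
      ⟨true, 80, 247, 301, 143, 174, 10843015622324, 17157719551396⟩ = true := by
  decide +kernel

set_option maxHeartbeats 100000000 in
/-- Shard 747: 80 cells of regime B from `143/174` to `107/130`.
[cite: Lai2024BallRivoal, §4 Lemma 4.3] -/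
theorem shard747 :
    Shard.check 128 (2^40)
      ⟨true, 80, 143, 174, 107, 130, 10807474151718, 17119163941679⟩ = true := by
  decide +kernel

set_option maxHeartbeats 100000000 in
/-- Shard 748: 80 cells of regime B from `107/130` to `352/427`.
[cite: Lai2024BallRivoal, §4 Lemma 4.3] -/
theorem shard748 :
    Shard.check 128 (2^40)
      ⟨true, 80, 107, 130, 352, 427, 11157787388828, 17692764044478⟩ = true := by
  decide +kernel

/-- The checked shards of this file, in order. [folklore] -/
def shards106 : List (CheckedShard 128 (2^40)) :=
  [⟨_, shard742⟩, ⟨_, shard743⟩, ⟨_, shard744⟩, ⟨_, shard745⟩, ⟨_, shard746⟩,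
    ⟨_, shard747⟩, ⟨_, shard748⟩]

end Summit.KontsevichZagierPeriods.Zeta5Search.Sweep
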